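import Literature.NumberTheory.GaloisRepresentations.LubinTateColemanUnitsImageSpecializationCharacterTwo
import Literature.NumberTheory.GaloisRepresentations.LubinTateColemanCoordCoinvariantTwistTwo
import Literature.NumberTheory.GaloisRepresentations.LubinTateColemanCoordMomentsSeparationUnramifiedTwo
import HarnessLib

/-!
# Brick (c) at `p = 2`, the SEAM at one `𝔓` and one unramified level — the WEIGHT-`k`, LEVEL-`m` READING OF THE DIVIDED SERIES `L` AT A
# NON-TRIVIAL CHARACTER `χ` OF `Gal(E_m/F)` (`χ(φ_m) = ζ`, `ζ^{p^m} = 1`, `X ↦ ζ − 1`): if `φ_ε(Σ_j Col β (j)) = (t_v·C g − n)·L` in `Λ = 𝒪_F⟦X⟧⟦T⟧`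
# then `(Σ_σ χ(σ⁻¹)σθ_m)·(v^{k+1}·g(ζ−1) − n)·L(ζ−1; γ^{k+1}−1)·mom_k(1) = Σ_{σ ∈ Gal(E_m/F)} χ(σ⁻¹)·σ(mom_k(r_{β,m}))` — de Shalit II §4.12 (31),
# series side, the `χ`-twin of `…SeamColemanDictionaryLevel` (T10₀-core)

Cell `bsd-print-cf2`, width seat `bsd-line-cf2c-w7` g32, route C `PrintCf2RubinValueTwo`, crux of record stmt-BirchSwinnertonDyer-24033
`TwoVariableMainConjAtSplitTwoQuad` (23720 nominal), BRICK §4(c), memo v13.1 (M2)(i)′ (the non-trivial characters of the unramified direction at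
one `𝔓`, one level); `--supports` the crux as a helper.  THEOREMS ONLY (0 sorry, no named fact, no definition); Theses-free; β-agnostic (any
base-norm-coherent family).  BSD is not proved by any of this.

De Shalit II §4.12 (31): the two-variable measure is pinned by `(N𝔞 − ε(σ_𝔞))·∫ ε dμ = ` (twisted Coates–Wiles values of the elliptic units) for the
characters `ε = χ·κ^{k}` of `𝒢`, `χ` of finite order on the unramified direction.  `…SeamColemanDictionaryLevel` (p837152) did `χ = 1` (`X ↦ 0`).
THIS file does every `χ` with `χ(φ_m) = ζ`, `ζ^{p^m} = 1`, through the print-free interface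
`LubinTateColemanUnitsImageSpecializationCharacterTwo` (ring map `κ : 𝒪_F⟦X⟧ → 𝒪_{E'}` over `𝒪_F` with `κ(X) = ζ − 1`, for a finite subextension
`E' ⊇ E_m` of `F̄` holding `ζ` and the values of `χ`; POSITED, not constructed):

* ★★★ `sum_character_coordMoment_relUnitCoordTwo_eq_of_colemanDeltaCoinvFun_indexTraceₗ_eq` — for a base-norm-coherent family `β = (β_m)`, a unit
  `v`, an `X`-series `g` with `g(0) = 1`, `n ∈ ℕ` and `L ∈ Λ` with `φ_ε(Σ_j Col β (j)) = (t_v·C g − C n)·L` (T10₀'s hypothesis VERBATIM), every level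
  `m`, weight `k` with `κ ε = (−1)^{k+1}`, and every such `(E', κ, ζ, χ)`:
  **`Σ_{σ ∈ Gal(E_m/F)} χ(σ⁻¹)·σ(mom_k(r_{β,m})) = (Σ_σ χ(σ⁻¹)σθ_m) · ((v^{k+1}·κ(g) − n) · tEval_{a_k}(κ L) · mom_k(1))`** in `𝒪_{E'}`,
  `a_k = γ^{k+1} − 1` — the `χ`-resolvent of the `k`-th Coates–Wiles moments of the level-`m` coordinate is the value of `L` at
  `(X, T) = (ζ − 1, γ^{k+1} − 1)` times the explicit factor `(Σ_σ χ(σ⁻¹)σθ_m)·(v^{k+1}·g(ζ−1) − n)·mom_k(1)`; here `κ(g) = g(ζ − 1)` is the value at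
  `σ_𝔟|_{E_m}` of the unramified character (`g ≡ (1+X)^a (mod ω_m)` for `σ_𝔟|_{E_m} = φ_m^a`), i.e. `v^{k+1}·κ(g) = ε(σ_𝔟)` in (31).
  Pieces, by name: `colemanDeltaCoinvFun_map_eq_of_eq_twist_mul` (§1 of the interface: base change of `φ_ε` and of `t_v` along `κ`),
  `tEval_mul_coordMoment_one_eq_of_eq_mul` (the one-level weight reading, over `𝒪_{E'}`), `sum_character_mul_coordMoment_specialization`
  (§5 of the interface: the `χ`-specialised trace).

HONEST LABEL: with T10₀ (`χ = 1`) this gives the level-`m` identity at EVERY character of `Gal(E_m/F)` trivial on the prime-to-`p` part `ℤ/d`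
(the characters seen by `Λ = 𝒪_F⟦X⟧⟦T⟧` through the index trace) — (M2)(i) at level `m`, GIVEN the ring data `(E', κ, ζ)`; the CONSTRUCTION of
`κ` (`X ↦ ζ − 1` into `𝒪_{E_m(ζ)}`, `‖ζ − 1‖ < 1`) is a separate statement, and the gluing over `m` / the period normalisation ((M2)(ii)(iii)) are
NOT here.  NOT progress on 24033 by itself.

## References
* [deShalit1987] E. de Shalit, *Iwasawa theory of elliptic curves with complex multiplication* (1987), I §3.1, §3.5 (11), §3.8 (16)–(17);
  II §4.7 (15)–(17), §4.12 (29)–(33); III §1.3, §1.8 (14)–(15), §1.10 (17).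
-/

noncomputable section

set_option linter.dupNamespace false
set_option autoImplicit false

open scoped PowerSeries.WithPiTopology

namespace Summit.BirchSwinnertonDyer.BirchSwinnertonDyer.Theorems.PrintCf2.SeamColemanDictionaryLevelCharacter

open ValuativeRel IsLocalRing Field Finset
open Literature.NumberTheory.GaloisRepresentations Literature.NumberTheory.GaloisRepresentations.IsNonarchimedeanLocalField
  Literature.NumberTheory.GaloisRepresentations.LubinTate

variable {F : Type} [Field F] [ValuativeRel F] [TopologicalSpace F] [IsNonarchimedeanLocalField F]

attribute [local instance] ltNormUniformSpace ltNormIsUniformAddGroup rk1 nF nE fintypeResidueField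

variable {p : ℕ} [hp : Fact p.Prime] {d : ℕ} [NeZero d] (hd : d.Coprime p)
variable {π : 𝒪[F]} (hπ : (valuation F).IsUniformizer (π : F))
variable (E : ℕ → IntermediateField F (AlgebraicClosure F)) [∀ m, FiniteDimensional F (E m)] [∀ m, Normal F (E m)]
  [∀ m, IsGalois F (E m)] (hmono : Monotone E) (hE : ∀ m, E m ≤ maxUnramified F) (hdeg : ∀ m, Module.finrank F (E m) = d * p ^ m)
  {σ₀ : absoluteGaloisGroup F} (hσ₀ : IsAbsArithFrob σ₀) (hq : residueFieldCard F = 2)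
variable (u : (LTCoeff F)ˣ) (hu : LTCoeff.of F π = residueFieldCard F * u) (γ : 𝒪[F]ˣ)
variable [IsAdicComplete (Ideal.span {intBase F (LTCoeff.of F π)}) (PowerSeries 𝒪[F])]
variable (w : 𝒪[F]ˣ) (hγ : (γ : 𝒪[F]) = 1 + π ^ 2 * w) (ε : PowerSeries (PowerSeries 𝒪[F]))
variable [IsAdicComplete (Ideal.span {(p : 𝒪[F])}) 𝒪[F]]
variable {θ : ∀ m, unitBall (E m)} (hθ : ∀ m, IsIntegralNormalGen (E m) (θ m))
  (hcoh : ∀ m, unitBallTrace (hmono (Nat.le_succ m)) (θ (m + 1)) = θ m)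

set_option maxHeartbeats 800000 in
include hdeg hE hσ₀ in
/-- ★★★ **THE WEIGHT-`k`, LEVEL-`m` READING OF THE DIVIDED SERIES AT A CHARACTER `χ` OF THE UNRAMIFIED DIRECTION** (de Shalit II §4.12 (31) on
the series side, one prime, `q = 2`; the `χ`-twin of `SeamColemanDictionaryLevel.sum_coordMoment_relUnitCoordTwo_eq_of_colemanDeltaCoinvFun_indexTraceₗ_eq`).
Let `β = (β_m)_m` be base-norm-coherent with two-variable Coleman transform `Col β`, and suppose `φ_ε(Σ_j Col β (j)) = (t_v·C g − C n)·L` in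
`Λ = 𝒪_F⟦X⟧⟦T⟧` for a unit `v ∈ 𝒪_F^×`, an `X`-series `g` with `g(0) = 1`, `n ∈ ℕ` and `L ∈ Λ`.  Let `E' ⊇ E_m` be a finite subextension of `F̄`,
`κ : 𝒪_F⟦X⟧ → 𝒪_{E'}` a ring map over `𝒪_F` with `κ(X) = ζ − 1`, `ζ^{p^m} = 1`, and `χ : Gal(E_m/F) → 𝒪_{E'}` a character with `χ(φ_m) = ζ`.  Then for
every weight `k` with `κ ε = (−1)^{k+1}`:
**`Σ_{σ ∈ Gal(E_m/F)} χ(σ⁻¹)·σ(mom_k(r_{β,m})) = (Σ_σ χ(σ⁻¹)σθ_m) · ((v^{k+1}·κ(g) − n) · tEval_{a_k}(κ L) · mom_k(1))`**, `a_k = γ^{k+1} − 1` — the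
`χ`-resolvent of the Coates–Wiles moments of the level-`m` coordinate is the value of `L` at `(X, T) = (ζ − 1, γ^{k+1} − 1)` times
`(Σ_σ χ(σ⁻¹)σθ_m)·(ε(σ) − n)·mom_k(1)` with `ε(σ) = v^{k+1}·g(ζ − 1)`.
[cite: deShalit1987, I §3.1, §3.5 (11), §3.8 (16)–(17); II §4.12 (29)–(31); III §1.8 (14)–(15)] -/
theorem sum_character_coordMoment_relUnitCoordTwo_eq_of_colemanDeltaCoinvFun_indexTraceₗ_eq
    {β : ∀ m, RelNormCoherentUnits hπ (E m)} (hβ : ∀ m, (β (m + 1)).baseNorm hπ (hmono (Nat.le_succ m)) = β m)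
    (v : 𝒪[F]ˣ) (g : PowerSeries 𝒪[F]) (hg : PowerSeries.constantCoeff g = 1) (n : ℕ) (L : PowerSeries (PowerSeries 𝒪[F]))
    (hL : colemanDeltaCoinvFun hπ hq (intBase F) u hu γ (eq_zero_of_C_pi_mul_eq_zero_integer hπ) w hγ ε
        (indexTraceₗ hπ hq u hu γ (colemanImage hd hπ E hmono hE hdeg hσ₀ hq u hu γ hθ hcoh hβ)) =
      (colemanDeltaCoinvFun hπ hq (intBase F) u hu γ (eq_zero_of_C_pi_mul_eq_zero_integer hπ) w hγ ε
          (unitTwistₗ hπ hq (intBase F) u hu γ v (TActModule.ofPS _ _ 1)) * PowerSeries.C g - PowerSeries.C ((n : ℕ) : PowerSeries 𝒪[F])) * L)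
    (m k : ℕ) {E' : IntermediateField F (AlgebraicClosure F)} [FiniteDimensional F E'] (hE' : E m ≤ E')
    [IsAdicComplete (Ideal.span {algebraMap (LTCoeff F) (unitBall E') (LTCoeff.of F π)}) (unitBall E')]
    (κ : PowerSeries 𝒪[F] →+* unitBall E') (hκ : κ.comp (intBase F) = algebraMap (LTCoeff F) (unitBall E'))
    (ζ : unitBall E') (hζ : ζ ^ p ^ m = 1) (hκX : κ PowerSeries.X = ζ - 1)
    (χ : (E m ≃ₐ[F] E m) →* unitBall E') (hχ : χ ((absoluteGaloisGroup.toAlgEquiv F σ₀).restrictNormal (E m)) = ζ)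
    (hεk : PowerSeries.map κ ε = (-1) ^ (k + 1)) :
    ∑ σ : E m ≃ₐ[F] E m, χ σ⁻¹ * inclUnitBall (F := F) hE' (unitBallEquiv (E m) σ
        (coordMoment hπ (E m) u k (relUnitCoordTwo hπ (E m) hq (hE m) hσ₀ u hu (β m)))) =
      (∑ σ : E m ≃ₐ[F] E m, χ σ⁻¹ * inclUnitBall (F := F) hE' (unitBallEquiv (E m) σ (θ m))) *
        ((algebraMap 𝒪[F] (unitBall E') (v : 𝒪[F]) ^ (k + 1) * κ g - (n : unitBall E')) *
          tEval (algebraMap_unit_pow_sub_one_mem hπ E' hq γ k) (PowerSeries.map κ L) * coordMoment hπ E' u k 1) := by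
  set x := indexTraceₗ hπ hq u hu γ (colemanImage hd hπ E hmono hE hdeg hσ₀ hq u hu γ hθ hcoh hβ) with hx
  have hreg' : ∀ y : unitBall E', algebraMap (LTCoeff F) (unitBall E') (LTCoeff.of F π) * y = 0 → y = 0 :=
    fun y hy ↦ eq_zero_of_algebraMap_ltCoeff_pi_mul_eq_zero hπ E' y hy
  -- §1 of the interface: the capstone relation read along `κ` (base change of `φ_ε` and of the twist scalar)
  have key := colemanDeltaCoinvFun_map_eq_of_eq_twist_mul hπ hq u hu γ (algebraMap (LTCoeff F) (unitBall E')) κ hκ hreg' w hγ ε x v g n L hL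
  rw [hεk] at key
  -- `κ g` is a unit (`g(0) = 1`): absorb it into `L`
  have hgu : IsUnit (κ g) := (PowerSeries.isUnit_iff_constantCoeff.mpr (by rw [hg]; exact isUnit_one)).map κ
  obtain ⟨c, hc⟩ := hgu
  have hcc : PowerSeries.C ((n : unitBall E') * ↑c⁻¹) * PowerSeries.C (κ g) = PowerSeries.C (n : unitBall E') := by
    rw [← map_mul, ← hc, mul_assoc, Units.inv_mul, mul_one]
  have key' : colemanDeltaCoinvFun hπ hq (algebraMap (LTCoeff F) (unitBall E')) u hu γ hreg' w hγ ((-1) ^ (k + 1))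
        (TActModule.ofPS _ _ (PowerSeries.map κ (TActModule.toPS x)) :
          ColemanCoordModule hπ hq (algebraMap (LTCoeff F) (unitBall E')) u hu γ) =
      (colemanDeltaCoinvFun hπ hq (algebraMap (LTCoeff F) (unitBall E')) u hu γ hreg' w hγ ((-1) ^ (k + 1))
          (unitTwistₗ hπ hq (algebraMap (LTCoeff F) (unitBall E')) u hu γ v (TActModule.ofPS _ _ 1)) -
        PowerSeries.C ((n : unitBall E') * ↑c⁻¹)) * (PowerSeries.C (κ g) * PowerSeries.map κ L) := by
    rw [key]
    linear_combination (PowerSeries.map κ L) * hcc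
  -- the one-level weight reading over `𝒪_{E'}`
  have hval := tEval_mul_coordMoment_one_eq_of_eq_mul hπ E' hq u hu γ hreg' w hγ k v (PowerSeries.C ((n : unitBall E') * ↑c⁻¹))
    (PowerSeries.C (κ g) * PowerSeries.map κ L) _ key'
  rw [TActModule.toPS_ofPS, tEval_C, tEval_mul, tEval_C] at hval
  have hcc' : (n : unitBall E') * ↑c⁻¹ * κ g = n := by rw [← hc, mul_assoc, Units.inv_mul, mul_one]
  have hval' : (algebraMap 𝒪[F] (unitBall E') (v : 𝒪[F]) ^ (k + 1) * κ g - (n : unitBall E')) *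
        tEval (algebraMap_unit_pow_sub_one_mem hπ E' hq γ k) (PowerSeries.map κ L) * coordMoment hπ E' u k 1 =
      coordMoment hπ E' u k (PowerSeries.map κ (TActModule.toPS x)) := by
    rw [← hval]
    linear_combination (tEval (algebraMap_unit_pow_sub_one_mem hπ E' hq γ k) (PowerSeries.map κ L) * coordMoment hπ E' u k 1) * hcc'
  -- the `χ`-specialised trace (§5 of the interface)
  have hH : PowerSeries.map κ (TActModule.toPS x) =
      PowerSeries.map κ (∑ j : ZMod d, TActModule.toPS (colemanImage hd hπ E hmono hE hdeg hσ₀ hq u hu γ hθ hcoh hβ j)) := by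
    rw [hx, indexTraceₗ_apply, map_sum]
  have hκC : ∀ a : 𝒪[F], κ (PowerSeries.C a) = algebraMap 𝒪[F] (unitBall E') a := fun a ↦ by
    have h := RingHom.congr_fun hκ (LTCoeff.of F a)
    rw [RingHom.comp_apply, intBase_of] at h
    exact h
  have hspec := sum_character_mul_coordMoment_specialization hd hπ E hmono hE hdeg hσ₀ hq u hu γ hθ hcoh hβ m k hE' κ hκC ζ hζ hκX χ hχ
  rw [← hH, ← hval'] at hspec
  exact hspec.symm

end Summit.BirchSwinnertonDyer.BirchSwinnertonDyer.Theorems.PrintCf2.SeamColemanDictionaryLevelCharacter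

end
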